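import Summits.QuantumFields.YangMills.Theorems.UnitScaleTiltProp7Taylor3Action
import Summits.QuantumFields.YangMills.Theorems.UnitScaleTiltProp7PointLandauBudget
import HarnessLib

/-!
# Route `UnitScaleTilt`, crux K1 «MinimiserStabilityRegPr» (stmt-QuantumFields-19200), lane α-P — THE HESS_W′ JUNCTION, FILE 1 (ROWS):
# the chart point `e^{iD}W` against the background `W` in the route-R fibre core's letters — relative plaquettes vs the linear word `ℒ_p(D)`,
# the bondwise dictionary `W′W^* − 1 = e^{iD} − 1`, and the divergence of the fluctuation from a divergence budget on `iD`

Cell `ym3-torus`, D-0154 (3c) twin-width seat `ym-routeR-w3` (gen 3).  THEOREMS ONLY (0 `def`, 0 `sorry`); `--supports stmt-QuantumFields-19200`, count-neutral.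
YM₃ on T³ is a ladder rung (R3), not the Clay problem; nothing here claims a stub, the crux, d = 4 or the mass gap.

THE POINT.  The α-P lane displays HESS_W′ per competitor with chart coordinate `D` (Hermitian traceless, `‖D(b)‖ ≤ s`): `κ·Σ_b‖D(b)‖² ≤ Σ_p‖ℒ_p(D)‖²`, `ℒ_p(D) = Z₁ + Z₂ − Z₃ − Z₄`
the linearised relative plaquette variable of `e^{iD}W` against `W(∂p)` (✓`Prop7Taylor3Word.norm_relPlaq_expChart_sub_lin_sub_quad_le`'s linear word).  The route-R fibre
core (✓`Prop7CurvedLandauCoreFibreFinalT3.relPoincare_on_fibre_T3`) speaks about a competitor `W′` through `Y = W′W^* − 1` (`pertVar W W′`), its backward covariant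
divergence `D^*_W Y` and the relative plaquettes `W′(∂p)W(∂p)^* − 1`.  This file supplies the three rows that read the core AT THE CHART POINT `W′ = e^{iD}W`:
(§1) `Σ_p‖W′(∂p)W(∂p)^* − 1‖² ≤ 2Σ_p‖ℒ_p(D)‖² + 31104s²Σ_b‖D(b)‖²` (second-order Taylor of the plaquette word, `4s ≤ 1`);
(§2) bondwise `Y(b) = e^{iD(b)} − 1`: `‖D(b)‖² ≤ 2‖Y(b)‖²`, `‖Y(b)‖² ≤ 2‖D(b)‖²`, `‖W′(b) − W(b)‖ ≤ 2‖D(b)‖` (`‖D(b)‖ ≤ ¼`);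
(§3) `Σ_x‖D^*_W Y(x)‖²_HS ≤ (2δ + 48s²)Σ_b‖D(b)‖² + 2Z` from a budget `Σ_x‖D^*_W(iD)(x)‖²_HS ≤ δΣ_b‖D(b)‖² + Z` (linear Landau gauge at `W` ⇒ `δ = Z = 0`).
FILE 2 (`…Prop7HessWOfFibreCoreT3`) composes them with the core into the HESS_W′ row.

WHAT IS PROVED (ns `…Theorems.Prop7HessWOfFibreCoreT3Rows`; T³, `SU(2)`).  §0 `normSq_le_two_add`, `normSq_le_of_taylor2` (scalars);
§1 `normSq_relPlaq_expChart_le`, ★ `sum_normSq_relPlaq_expChart_le`; §2 `pertVar_expChart_eq`, `norm_pertVar_sub_lin_le`, `norm_pertVar_expChart_le`,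
`normSq_D_le_two_normSq_pertVar`, `normSq_pertVar_le_two_normSq_D`, `norm_expChart_sub_le`; §3 ★ `sum_hs_divB_le` (stencil bound `Σ_x‖D^*_W R‖²_HS ≤ 24Σ_b‖R(b)‖²`),
★ `sum_hs_divB_pertVar_le_of_budget`.

HONEST SCOPE.  Bookkeeping over the landed chart rows (✓`Prop7Taylor3ExpChart`, ✓`Prop7Taylor3Word`) and the divergence letters (✓`Prop7PointLandauDivergence.divB_apply`,
✓`Prop7PointLandauBudget.sum_incident_eq`); absolute constants; nothing of [Balaban1985Variational] is asserted.

References: T. Bałaban, CMP 102 (1985) 277–309 [Balaban1985Variational] ((15) p.280, (19)–(26) pp.281–282, (112) p.294, (141)–(142) p.299); CMP 99 (1985) 389–434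
[Balaban1985BackgroundPropagators] ((3.8) p.392); CMP 99 (1985) 75–102 [Balaban1985RegularSpaces] ((1.29) p.81).
-/

set_option autoImplicit false

noncomputable section

open scoped BigOperators Matrix.Norms.L2Operator Matrix

namespace Summit.QuantumFields.YangMills.Theorems.Prop7HessWOfFibreCoreT3Rows

open NormedSpace
open Literature.MathematicalPhysics.QuantumFieldTheory.Balaban1983to89
open Literature.MathematicalPhysics.QuantumFieldTheory.Balaban1983to89.T3ContinuumYM3Torus
open Literature.MathematicalPhysics.QuantumFieldTheory.Balaban1983to89.T3SectALandauChart (emb15)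
open Finset T4Continuum BlockAveraging AveragingRT ExpMeanLog BlockAveragingEMLLinearised BlockAveragingEMLLinearisedBackground BlockAveragingEMLProp2 B1RG242Torus
open B9Eq39Adjoint (divB covDstar_add)
open B10Eq27TorusAxialLog (unitsField toUField)
open B9TorusCalculus (torusT)
open Summit.QuantumFields.YangMills.Theorems.Prop7TPrint (expHermField)
open Summit.QuantumFields.YangMills.Theorems.Prop7Taylor3ExpChart (norm_I_smul pertY_expChart_eq norm_pertY_sub_lin_le norm_pertY_le)
open Summit.QuantumFields.YangMills.Theorems.Prop7Taylor3Word (norm_quad_le norm_relPlaq_expChart_sub_lin_sub_quad_le)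
open Summit.QuantumFields.YangMills.Theorems.PerturbedPlaquette (norm_conj_SU)
open Summit.QuantumFields.YangMills.Theorems.Prop7FlatLocalMin (sum_plaq_bonds_le)
open Summit.QuantumFields.YangMills.Theorems.Prop7CovariantCoercivity (sum_norm_sq_le_mul_opNorm_sq)
open Summit.QuantumFields.YangMills.Theorems.Prop7PointLandauDivergence (divB_apply)
open Summit.QuantumFields.YangMills.Theorems.Prop7PointLandauBudget (sum_incident_eq)

variable {F : T3Family} {K : ℕ}

/-! ## §0 Scalars -/

/-- `‖x‖² ≤ 2‖L‖² + 2‖x − L‖²`. [folklore] -/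
theorem normSq_le_two_add {E : Type*} [SeminormedAddCommGroup E] (x L : E) : ‖x‖ ^ 2 ≤ 2 * ‖L‖ ^ 2 + 2 * ‖x - L‖ ^ 2 := by
  have h : ‖x‖ ≤ ‖L‖ + ‖x - L‖ := by
    have := norm_add_le L (x - L); rwa [add_sub_cancel] at this
  nlinarith [norm_nonneg x, norm_nonneg L, norm_nonneg (x - L), sq_nonneg (‖L‖ - ‖x - L‖)]

/-- **THE SECOND-ORDER TAYLOR BOOKKEEPING, ABSTRACTLY**: `‖Q‖ ≤ ½σ²`, `‖x − L − Q‖ ≤ 4σ³`, `0 ≤ σ ≤ 4s ≤ 1`, `σ² ≤ 4S` ⟹ `‖x‖² ≤ 2‖L‖² + 2592·s²·S`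
(`‖x − L‖ ≤ (9∕2)σ²`, `σ⁴ ≤ 16s²·4S`). [folklore] -/
theorem normSq_le_of_taylor2 {E : Type*} [SeminormedAddCommGroup E] (x L Q : E) {σ s S : ℝ} (hσ0 : 0 ≤ σ) (hσs : σ ≤ 4 * s) (hs4 : 4 * s ≤ 1)
    (hσS : σ ^ 2 ≤ 4 * S) (hQ : ‖Q‖ ≤ (1 / 2) * σ ^ 2) (hR : ‖x - L - Q‖ ≤ 4 * σ ^ 3) :
    ‖x‖ ^ 2 ≤ 2 * ‖L‖ ^ 2 + 2592 * s ^ 2 * S := by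
  have hσ1 : σ ≤ 1 := hσs.trans hs4
  have hxL : ‖x - L‖ ≤ (9 / 2) * σ ^ 2 := by
    have h := norm_add_le (x - L - Q) Q
    rw [sub_add_cancel] at h
    have : σ ^ 3 ≤ σ ^ 2 := by nlinarith
    linarith
  have h2 := normSq_le_two_add x L
  have hxL2 : ‖x - L‖ ^ 2 ≤ ((9 / 2) * σ ^ 2) ^ 2 := pow_le_pow_left₀ (norm_nonneg _) hxL 2
  have hσ2s : σ ^ 2 ≤ 16 * s ^ 2 := by
    have := pow_le_pow_left₀ hσ0 hσs 2; nlinarith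
  have h4 : ((9 / 2) * σ ^ 2) ^ 2 ≤ 1296 * s ^ 2 * S := by
    have := mul_le_mul hσ2s hσS (by positivity) (by positivity)
    nlinarith
  linarith

/-! ## §1 The relative plaquette variable of the chart point against its linearisation `ℒ_p(D)`, in mean square -/

set_option maxHeartbeats 400000 in
/-- **PER PLAQUETTE**: for `D` Hermitian traceless with `‖D(b)‖ ≤ s`, `4s ≤ 1`:
`‖(e^{iD}W)(∂p)W(∂p)^* − 1‖² ≤ 2‖ℒ_p(D)‖² + 2592·s²·Σ_{b∈∂p}‖D(b)‖²` (✓`norm_relPlaq_expChart_sub_lin_sub_quad_le` + ✓`norm_quad_le` + §0).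
[cite: Balaban1985Variational, (22)-(26) pp.281-282, (112) p.294, (141)-(142) p.299] -/
theorem normSq_relPlaq_expChart_le (W : GaugeField (F.P K) 0 (Matrix.specialUnitaryGroup (Fin 2) ℂ)) (D : PBond (F.P K) 0 → Matrix (Fin 2) (Fin 2) ℂ)
    (hD : ∀ b : PBond (F.P K) 0, (D b).IsHermitian ∧ Matrix.trace (D b) = 0) {s : ℝ} (hs : ∀ b : PBond (F.P K) 0, ‖D b‖ ≤ s) (hs4 : 4 * s ≤ 1)
    (p : Plaq (F.P K) 0) :
    ‖((GaugeField.plaqHol (emb15 W (expHermField D)) p : Matrix.specialUnitaryGroup (Fin 2) ℂ) : Matrix (Fin 2) (Fin 2) ℂ)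
        * star ((GaugeField.plaqHol W p : Matrix.specialUnitaryGroup (Fin 2) ℂ) : Matrix (Fin 2) (Fin 2) ℂ) - 1‖ ^ 2
      ≤ 2 * ‖((Complex.I • D ⟨p.src, p.μ⟩) + ((W ⟨p.src, p.μ⟩ : Matrix (Fin 2) (Fin 2) ℂ) * (Complex.I • D ⟨p.src.shift p.μ, p.ν⟩) * star (W ⟨p.src, p.μ⟩ : Matrix (Fin 2) (Fin 2) ℂ))
            - (((W ⟨p.src, p.μ⟩ * W ⟨p.src.shift p.μ, p.ν⟩ * (W ⟨p.src.shift p.ν, p.μ⟩)⁻¹ : Matrix.specialUnitaryGroup (Fin 2) ℂ) : Matrix (Fin 2) (Fin 2) ℂ) * (Complex.I • D ⟨p.src.shift p.ν, p.μ⟩) * star ((W ⟨p.src, p.μ⟩ * W ⟨p.src.shift p.μ, p.ν⟩ * (W ⟨p.src.shift p.ν, p.μ⟩)⁻¹ : Matrix.specialUnitaryGroup (Fin 2) ℂ) : Matrix (Fin 2) (Fin 2) ℂ))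
            - (((GaugeField.plaqHol W p : Matrix.specialUnitaryGroup (Fin 2) ℂ) : Matrix (Fin 2) (Fin 2) ℂ) * (Complex.I • D ⟨p.src, p.ν⟩) * star ((GaugeField.plaqHol W p : Matrix.specialUnitaryGroup (Fin 2) ℂ) : Matrix (Fin 2) (Fin 2) ℂ)))‖ ^ 2
        + 2592 * s ^ 2 * (‖D ⟨p.src, p.μ⟩‖ ^ 2 + ‖D ⟨p.src.shift p.μ, p.ν⟩‖ ^ 2 + ‖D ⟨p.src.shift p.ν, p.μ⟩‖ ^ 2 + ‖D ⟨p.src, p.ν⟩‖ ^ 2) := by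
  have h1 : ∀ b : PBond (F.P K) 0, ‖D b‖ ≤ 1 := fun b => (hs b).trans (by linarith)
  have n₁ : ‖(Complex.I • D ⟨p.src, p.μ⟩)‖ ≤ ‖D ⟨p.src, p.μ⟩‖ := (norm_I_smul _).le
  have n₂ : ‖((W ⟨p.src, p.μ⟩ : Matrix (Fin 2) (Fin 2) ℂ) * (Complex.I • D ⟨p.src.shift p.μ, p.ν⟩) * star (W ⟨p.src, p.μ⟩ : Matrix (Fin 2) (Fin 2) ℂ))‖ ≤ ‖D ⟨p.src.shift p.μ, p.ν⟩‖ := by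
    rw [norm_conj_SU, norm_I_smul]
  have n₃ : ‖(((W ⟨p.src, p.μ⟩ * W ⟨p.src.shift p.μ, p.ν⟩ * (W ⟨p.src.shift p.ν, p.μ⟩)⁻¹ : Matrix.specialUnitaryGroup (Fin 2) ℂ) : Matrix (Fin 2) (Fin 2) ℂ) * (Complex.I • D ⟨p.src.shift p.ν, p.μ⟩) * star ((W ⟨p.src, p.μ⟩ * W ⟨p.src.shift p.μ, p.ν⟩ * (W ⟨p.src.shift p.ν, p.μ⟩)⁻¹ : Matrix.specialUnitaryGroup (Fin 2) ℂ) : Matrix (Fin 2) (Fin 2) ℂ))‖ ≤ ‖D ⟨p.src.shift p.ν, p.μ⟩‖ := by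
    rw [norm_conj_SU, norm_I_smul]
  have n₄ : ‖(((GaugeField.plaqHol W p : Matrix.specialUnitaryGroup (Fin 2) ℂ) : Matrix (Fin 2) (Fin 2) ℂ) * (Complex.I • D ⟨p.src, p.ν⟩) * star ((GaugeField.plaqHol W p : Matrix.specialUnitaryGroup (Fin 2) ℂ) : Matrix (Fin 2) (Fin 2) ℂ))‖ ≤ ‖D ⟨p.src, p.ν⟩‖ := by
    rw [norm_conj_SU, norm_I_smul]
  have hQ := norm_quad_le _ _ _ _ (norm_nonneg _) (norm_nonneg _) (norm_nonneg _) (norm_nonneg _) n₁ n₂ n₃ n₄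
  have hR := norm_relPlaq_expChart_sub_lin_sub_quad_le W D p hD h1
  have hσs : ‖D ⟨p.src, p.μ⟩‖ + ‖D ⟨p.src.shift p.μ, p.ν⟩‖ + ‖D ⟨p.src.shift p.ν, p.μ⟩‖ + ‖D ⟨p.src, p.ν⟩‖ ≤ 4 * s := by
    linarith [hs ⟨p.src, p.μ⟩, hs ⟨p.src.shift p.μ, p.ν⟩, hs ⟨p.src.shift p.ν, p.μ⟩, hs ⟨p.src, p.ν⟩]
  have hσS : (‖D ⟨p.src, p.μ⟩‖ + ‖D ⟨p.src.shift p.μ, p.ν⟩‖ + ‖D ⟨p.src.shift p.ν, p.μ⟩‖ + ‖D ⟨p.src, p.ν⟩‖) ^ 2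
      ≤ 4 * (‖D ⟨p.src, p.μ⟩‖ ^ 2 + ‖D ⟨p.src.shift p.μ, p.ν⟩‖ ^ 2 + ‖D ⟨p.src.shift p.ν, p.μ⟩‖ ^ 2 + ‖D ⟨p.src, p.ν⟩‖ ^ 2) := by
    nlinarith [sq_nonneg (‖D ⟨p.src, p.μ⟩‖ - ‖D ⟨p.src.shift p.μ, p.ν⟩‖), sq_nonneg (‖D ⟨p.src, p.μ⟩‖ - ‖D ⟨p.src.shift p.ν, p.μ⟩‖),
      sq_nonneg (‖D ⟨p.src, p.μ⟩‖ - ‖D ⟨p.src, p.ν⟩‖), sq_nonneg (‖D ⟨p.src.shift p.μ, p.ν⟩‖ - ‖D ⟨p.src.shift p.ν, p.μ⟩‖),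
      sq_nonneg (‖D ⟨p.src.shift p.μ, p.ν⟩‖ - ‖D ⟨p.src, p.ν⟩‖), sq_nonneg (‖D ⟨p.src.shift p.ν, p.μ⟩‖ - ‖D ⟨p.src, p.ν⟩‖)]
  have hfin := normSq_le_of_taylor2 _ _ _ (by positivity) hσs hs4 hσS hQ hR
  exact hfin

/-- ★ **SUMMED OVER THE PLAQUETTES** (each bond in `4d = 12` plaquette slots, ✓`sum_plaq_bonds_le`): `Σ_p‖(e^{iD}W)(∂p)W(∂p)^* − 1‖² ≤ 2Σ_p‖ℒ_p(D)‖² + 31104·s²·Σ_b‖D(b)‖²`.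
[cite: Balaban1985Variational, (22)-(26) pp.281-282, (141)-(142) p.299] -/
theorem sum_normSq_relPlaq_expChart_le (W : GaugeField (F.P K) 0 (Matrix.specialUnitaryGroup (Fin 2) ℂ)) (D : PBond (F.P K) 0 → Matrix (Fin 2) (Fin 2) ℂ)
    (hD : ∀ b : PBond (F.P K) 0, (D b).IsHermitian ∧ Matrix.trace (D b) = 0) {s : ℝ} (hs : ∀ b : PBond (F.P K) 0, ‖D b‖ ≤ s) (hs4 : 4 * s ≤ 1) :
    ∑ p : Plaq (F.P K) 0, ‖((GaugeField.plaqHol (emb15 W (expHermField D)) p : Matrix.specialUnitaryGroup (Fin 2) ℂ) : Matrix (Fin 2) (Fin 2) ℂ)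
        * star ((GaugeField.plaqHol W p : Matrix.specialUnitaryGroup (Fin 2) ℂ) : Matrix (Fin 2) (Fin 2) ℂ) - 1‖ ^ 2
      ≤ 2 * ∑ p : Plaq (F.P K) 0, ‖((Complex.I • D ⟨p.src, p.μ⟩) + ((W ⟨p.src, p.μ⟩ : Matrix (Fin 2) (Fin 2) ℂ) * (Complex.I • D ⟨p.src.shift p.μ, p.ν⟩) * star (W ⟨p.src, p.μ⟩ : Matrix (Fin 2) (Fin 2) ℂ))
            - (((W ⟨p.src, p.μ⟩ * W ⟨p.src.shift p.μ, p.ν⟩ * (W ⟨p.src.shift p.ν, p.μ⟩)⁻¹ : Matrix.specialUnitaryGroup (Fin 2) ℂ) : Matrix (Fin 2) (Fin 2) ℂ) * (Complex.I • D ⟨p.src.shift p.ν, p.μ⟩) * star ((W ⟨p.src, p.μ⟩ * W ⟨p.src.shift p.μ, p.ν⟩ * (W ⟨p.src.shift p.ν, p.μ⟩)⁻¹ : Matrix.specialUnitaryGroup (Fin 2) ℂ) : Matrix (Fin 2) (Fin 2) ℂ))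
            - (((GaugeField.plaqHol W p : Matrix.specialUnitaryGroup (Fin 2) ℂ) : Matrix (Fin 2) (Fin 2) ℂ) * (Complex.I • D ⟨p.src, p.ν⟩) * star ((GaugeField.plaqHol W p : Matrix.specialUnitaryGroup (Fin 2) ℂ) : Matrix (Fin 2) (Fin 2) ℂ)))‖ ^ 2
        + 31104 * s ^ 2 * ∑ b : PBond (F.P K) 0, ‖D b‖ ^ 2 := by
  have hinc := sum_plaq_bonds_le (P := F.P K) (j := 0) (fun b => ‖D b‖ ^ 2) (fun b => sq_nonneg _)
  have hd : ((F.P K).d : ℝ) = 3 := by norm_num [T3Family.P_d]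
  rw [hd] at hinc
  have hsum := Finset.sum_le_sum fun p (_ : p ∈ (Finset.univ : Finset (Plaq (F.P K) 0))) => normSq_relPlaq_expChart_le W D hD hs hs4 p
  rw [Finset.sum_add_distrib, ← Finset.mul_sum, ← Finset.mul_sum] at hsum
  have := mul_le_mul_of_nonneg_left hinc (show (0 : ℝ) ≤ 2592 * s ^ 2 by positivity)
  linarith

/-! ## §2 The bondwise dictionary `W′W^* − 1 = e^{iD} − 1` of the chart point `W′ = e^{iD}W` -/

/-- `pertVar W (e^{iD}W)(b) = e^{iD(b)} − 1`. [cite: Balaban1985Variational, (15) p.280, (112) p.294] -/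
theorem pertVar_expChart_eq (W : GaugeField (F.P K) 0 (Matrix.specialUnitaryGroup (Fin 2) ℂ)) (D : PBond (F.P K) 0 → Matrix (Fin 2) (Fin 2) ℂ)
    (b : PBond (F.P K) 0) (hD : (D b).IsHermitian ∧ Matrix.trace (D b) = 0) :
    pertVar W (emb15 W (expHermField D)) b = exp (Complex.I • D b) - 1 := by
  rw [pertVar_eq]; exact pertY_expChart_eq W D b hD

/-- `‖pertVar W (e^{iD}W)(b) − iD(b)‖ ≤ ‖D(b)‖²` on `‖D(b)‖ ≤ 1`. [cite: Balaban1985Variational, (22) p.281, (112) p.294] -/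
theorem norm_pertVar_sub_lin_le (W : GaugeField (F.P K) 0 (Matrix.specialUnitaryGroup (Fin 2) ℂ)) (D : PBond (F.P K) 0 → Matrix (Fin 2) (Fin 2) ℂ)
    (b : PBond (F.P K) 0) (hD : (D b).IsHermitian ∧ Matrix.trace (D b) = 0) (h1 : ‖D b‖ ≤ 1) :
    ‖pertVar W (emb15 W (expHermField D)) b - Complex.I • D b‖ ≤ ‖D b‖ ^ 2 := by
  rw [pertVar_eq]; exact norm_pertY_sub_lin_le W D b hD h1

/-- `‖pertVar W (e^{iD}W)(b)‖ ≤ 2‖D(b)‖` on `‖D(b)‖ ≤ 1`. [cite: Balaban1985Variational, (19) p.281, (22) p.281] -/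
theorem norm_pertVar_expChart_le (W : GaugeField (F.P K) 0 (Matrix.specialUnitaryGroup (Fin 2) ℂ)) (D : PBond (F.P K) 0 → Matrix (Fin 2) (Fin 2) ℂ)
    (b : PBond (F.P K) 0) (hD : (D b).IsHermitian ∧ Matrix.trace (D b) = 0) (h1 : ‖D b‖ ≤ 1) :
    ‖pertVar W (emb15 W (expHermField D)) b‖ ≤ 2 * ‖D b‖ := by
  rw [pertVar_eq]; exact norm_pertY_le W D b hD h1

/-- `‖D(b)‖² ≤ 2‖pertVar W (e^{iD}W)(b)‖²` on `‖D(b)‖ ≤ ¼` (`‖iD‖ ≤ ‖Y‖ + ‖D‖² ≤ ‖Y‖ + ¼‖D‖`). [cite: Balaban1985Variational, (22) p.281] -/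
theorem normSq_D_le_two_normSq_pertVar (W : GaugeField (F.P K) 0 (Matrix.specialUnitaryGroup (Fin 2) ℂ)) (D : PBond (F.P K) 0 → Matrix (Fin 2) (Fin 2) ℂ)
    (b : PBond (F.P K) 0) (hD : (D b).IsHermitian ∧ Matrix.trace (D b) = 0) (h4 : ‖D b‖ ≤ 1 / 4) :
    ‖D b‖ ^ 2 ≤ 2 * ‖pertVar W (emb15 W (expHermField D)) b‖ ^ 2 := by
  have h1 : ‖D b‖ ≤ 1 := h4.trans (by norm_num)
  have hr := norm_pertVar_sub_lin_le W D b hD h1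
  have ht : ‖Complex.I • D b‖ ≤ ‖pertVar W (emb15 W (expHermField D)) b‖ + ‖pertVar W (emb15 W (expHermField D)) b - Complex.I • D b‖ := by
    have := norm_sub_le (pertVar W (emb15 W (expHermField D)) b) (pertVar W (emb15 W (expHermField D)) b - Complex.I • D b)
    rwa [sub_sub_cancel] at this
  rw [norm_I_smul] at ht
  have hD2 : ‖D b‖ ^ 2 ≤ (1 / 4) * ‖D b‖ := by nlinarith [norm_nonneg (D b)]
  nlinarith [norm_nonneg (D b), norm_nonneg (pertVar W (emb15 W (expHermField D)) b)]

/-- `‖pertVar W (e^{iD}W)(b)‖² ≤ 2‖D(b)‖²` on `‖D(b)‖ ≤ ¼` (`‖Y‖ ≤ ‖D‖ + ‖D‖² ≤ (5∕4)‖D‖`). [cite: Balaban1985Variational, (22) p.281] -/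
theorem normSq_pertVar_le_two_normSq_D (W : GaugeField (F.P K) 0 (Matrix.specialUnitaryGroup (Fin 2) ℂ)) (D : PBond (F.P K) 0 → Matrix (Fin 2) (Fin 2) ℂ)
    (b : PBond (F.P K) 0) (hD : (D b).IsHermitian ∧ Matrix.trace (D b) = 0) (h4 : ‖D b‖ ≤ 1 / 4) :
    ‖pertVar W (emb15 W (expHermField D)) b‖ ^ 2 ≤ 2 * ‖D b‖ ^ 2 := by
  have h1 : ‖D b‖ ≤ 1 := h4.trans (by norm_num)
  have hr := norm_pertVar_sub_lin_le W D b hD h1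
  have ht : ‖pertVar W (emb15 W (expHermField D)) b‖ ≤ ‖Complex.I • D b‖ + ‖pertVar W (emb15 W (expHermField D)) b - Complex.I • D b‖ := by
    have := norm_add_le (Complex.I • D b) (pertVar W (emb15 W (expHermField D)) b - Complex.I • D b)
    rwa [add_sub_cancel] at this
  rw [norm_I_smul] at ht
  have hD2 : ‖D b‖ ^ 2 ≤ (1 / 4) * ‖D b‖ := by nlinarith [norm_nonneg (D b)]
  have hY : ‖pertVar W (emb15 W (expHermField D)) b‖ ≤ (5 / 4) * ‖D b‖ := by linarith
  nlinarith [norm_nonneg (D b), norm_nonneg (pertVar W (emb15 W (expHermField D)) b)]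

/-- **THE COMPETITOR's SUP DISTANCE**: `‖(e^{iD}W)(b) − W(b)‖ = ‖pertVar W (e^{iD}W)(b)‖ ≤ 2‖D(b)‖` on `‖D(b)‖ ≤ 1`. [cite: Balaban1985Variational, (19) p.281] -/
theorem norm_expChart_sub_le (W : GaugeField (F.P K) 0 (Matrix.specialUnitaryGroup (Fin 2) ℂ)) (D : PBond (F.P K) 0 → Matrix (Fin 2) (Fin 2) ℂ)
    (b : PBond (F.P K) 0) (hD : (D b).IsHermitian ∧ Matrix.trace (D b) = 0) (h1 : ‖D b‖ ≤ 1) :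
    ‖((emb15 W (expHermField D) b : Matrix.specialUnitaryGroup (Fin 2) ℂ) : Matrix (Fin 2) (Fin 2) ℂ) - ((W b : Matrix.specialUnitaryGroup (Fin 2) ℂ) : Matrix (Fin 2) (Fin 2) ℂ)‖
      ≤ 2 * ‖D b‖ := by
  have hWW : star ((W b : Matrix.specialUnitaryGroup (Fin 2) ℂ) : Matrix (Fin 2) (Fin 2) ℂ) * ((W b : Matrix.specialUnitaryGroup (Fin 2) ℂ) : Matrix (Fin 2) (Fin 2) ℂ) = 1 :=
    Matrix.mem_unitaryGroup_iff'.mp (W b).2.1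
  have e : ((emb15 W (expHermField D) b : Matrix.specialUnitaryGroup (Fin 2) ℂ) : Matrix (Fin 2) (Fin 2) ℂ) - ((W b : Matrix.specialUnitaryGroup (Fin 2) ℂ) : Matrix (Fin 2) (Fin 2) ℂ)
      = pertVar W (emb15 W (expHermField D)) b * ((W b : Matrix.specialUnitaryGroup (Fin 2) ℂ) : Matrix (Fin 2) (Fin 2) ℂ) := by
    rw [pertVar_eq, sub_mul, Matrix.one_mul, Matrix.mul_assoc, hWW, Matrix.mul_one]
  rw [e, CStarRing.norm_mul_mem_unitary _ (W b).2.1]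
  exact norm_pertVar_expChart_le W D b hD h1

/-! ## §3 The divergence of the chart point's fluctuation from a divergence budget on `iD` -/

/-- ★ **STENCIL BOUND**: `Σ_xΣ_jk|(D^*_W R)(x)_jk|² ≤ 24·Σ_b‖R(b)‖²` for every bond field `R` (`|D^*R(x)| ≤ Σ_μ(|R(x−e_μ,μ)| + |R(x,μ)|)` by ✓`divB_apply`, Cauchy–Schwarz over
the `d = 3` directions, `HS ≤ 2·op²` on `M₂(ℂ)`, both ends of every bond ✓`sum_incident_eq`). [cite: Balaban1985BackgroundPropagators, (3.8) p.392] -/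
theorem sum_hs_divB_le (W : GaugeField (F.P K) 0 (Matrix.specialUnitaryGroup (Fin 2) ℂ)) (R : PBond (F.P K) 0 → Matrix (Fin 2) (Fin 2) ℂ) :
    ∑ x : Site (F.P K) 0, ∑ j : Fin 2, ∑ k : Fin 2,
        ‖(divB (torusT (F.P K) 0) (fun κ z => unitsField (toUField W) ⟨z, κ⟩) (fun κ z => R ⟨z, κ⟩) x) j k‖ ^ 2
      ≤ 24 * ∑ b : PBond (F.P K) 0, ‖R b‖ ^ 2 := by
  have hd : ((F.P K).d : ℝ) = 3 := by norm_num [T3Family.P_d]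
  have hper : ∀ x : Site (F.P K) 0, ∑ j : Fin 2, ∑ k : Fin 2,
        ‖(divB (torusT (F.P K) 0) (fun κ z => unitsField (toUField W) ⟨z, κ⟩) (fun κ z => R ⟨z, κ⟩) x) j k‖ ^ 2
      ≤ 12 * (∑ μ : Fin (F.P K).d, ‖R ⟨x, μ⟩‖ ^ 2 + ∑ μ : Fin (F.P K).d, ‖R ⟨x.unshift μ, μ⟩‖ ^ 2) := by
    intro x
    have hHS := sum_norm_sq_le_mul_opNorm_sq (divB (torusT (F.P K) 0) (fun κ z => unitsField (toUField W) ⟨z, κ⟩) (fun κ z => R ⟨z, κ⟩) x)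
    push_cast at hHS
    -- operator norm of the divergence at `x`
    have hn : ‖divB (torusT (F.P K) 0) (fun κ z => unitsField (toUField W) ⟨z, κ⟩) (fun κ z => R ⟨z, κ⟩) x‖
        ≤ ∑ μ : Fin (F.P K).d, (‖R ⟨x.unshift μ, μ⟩‖ + ‖R ⟨x, μ⟩‖) := by
      rw [divB_apply]
      refine (norm_sum_le _ _).trans (Finset.sum_le_sum fun μ _ => ?_)
      refine (norm_sub_le _ _).trans (add_le_add ?_ le_rfl)
      rw [CStarRing.norm_mul_mem_unitary _ (W ⟨x.unshift μ, μ⟩).2.1, CStarRing.norm_mem_unitary_mul _ (Unitary.star_mem (W ⟨x.unshift μ, μ⟩).2.1)]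
    have h0 : 0 ≤ ‖divB (torusT (F.P K) 0) (fun κ z => unitsField (toUField W) ⟨z, κ⟩) (fun κ z => R ⟨z, κ⟩) x‖ := norm_nonneg _
    have hsq := pow_le_pow_left₀ h0 hn 2
    -- Cauchy–Schwarz over the `d = 3` directions
    have hCS := sq_sum_le_card_mul_sum_sq (s := (Finset.univ : Finset (Fin (F.P K).d))) (f := fun μ => ‖R ⟨x.unshift μ, μ⟩‖ + ‖R ⟨x, μ⟩‖)
    rw [Finset.card_univ, Fintype.card_fin, hd] at hCS
    have hab : ∑ μ : Fin (F.P K).d, (‖R ⟨x.unshift μ, μ⟩‖ + ‖R ⟨x, μ⟩‖) ^ 2 ≤ 2 * (∑ μ : Fin (F.P K).d, ‖R ⟨x, μ⟩‖ ^ 2 + ∑ μ : Fin (F.P K).d, ‖R ⟨x.unshift μ, μ⟩‖ ^ 2) := by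
      rw [mul_add, Finset.mul_sum, Finset.mul_sum, ← Finset.sum_add_distrib]
      exact Finset.sum_le_sum fun μ _ => by nlinarith [sq_nonneg (‖R ⟨x.unshift μ, μ⟩‖ - ‖R ⟨x, μ⟩‖)]
    nlinarith [hHS, hsq, hCS, hab]
  calc _ ≤ ∑ x : Site (F.P K) 0, 12 * (∑ μ : Fin (F.P K).d, ‖R ⟨x, μ⟩‖ ^ 2 + ∑ μ : Fin (F.P K).d, ‖R ⟨x.unshift μ, μ⟩‖ ^ 2) :=
        Finset.sum_le_sum fun x _ => hper x
    _ = 12 * (2 * ∑ b : PBond (F.P K) 0, ‖R b‖ ^ 2) := by rw [← Finset.mul_sum, sum_incident_eq (fun b => ‖R b‖ ^ 2)]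
    _ = 24 * ∑ b : PBond (F.P K) 0, ‖R b‖ ^ 2 := by ring

/-- `D^*_W` is additive in the bond field (✓`B9Eq39Adjoint.covDstar_add` summed). [folklore] -/
theorem divB_add_field (W : GaugeField (F.P K) 0 (Matrix.specialUnitaryGroup (Fin 2) ℂ)) (A B : Fin (F.P K).d → Site (F.P K) 0 → Matrix (Fin 2) (Fin 2) ℂ)
    (x : Site (F.P K) 0) :
    divB (torusT (F.P K) 0) (fun κ z => unitsField (toUField W) ⟨z, κ⟩) (fun κ z => A κ z + B κ z) x
      = divB (torusT (F.P K) 0) (fun κ z => unitsField (toUField W) ⟨z, κ⟩) A x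
        + divB (torusT (F.P K) 0) (fun κ z => unitsField (toUField W) ⟨z, κ⟩) B x := by
  simp only [divB, ← Finset.sum_add_distrib]
  exact Finset.sum_congr rfl fun μ _ => covDstar_add _ _ μ (A μ) (B μ) x

/-- ★ **THE DIVERGENCE BUDGET OF THE CHART POINT's FLUCTUATION**: for `D` Hermitian traceless with `‖D(b)‖ ≤ s ≤ 1` and a budget `Σ_xΣ_jk|(D^*_W(iD))(x)_jk|² ≤ δΣ_b‖D(b)‖² + Z`:
`Σ_xΣ_jk|(D^*_W(W′W^* − 1))(x)_jk|² ≤ (2δ + 48s²)·Σ_b‖D(b)‖² + 2Z`, `W′ = e^{iD}W` (additivity of `D^*_W`, `‖e^{iD} − 1 − iD‖ ≤ ‖D‖² ≤ s‖D‖`, the stencil bound).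
[cite: Balaban1985BackgroundPropagators, (3.8) p.392; Balaban1985RegularSpaces, (1.29) p.81] -/
theorem sum_hs_divB_pertVar_le_of_budget (W : GaugeField (F.P K) 0 (Matrix.specialUnitaryGroup (Fin 2) ℂ)) (D : PBond (F.P K) 0 → Matrix (Fin 2) (Fin 2) ℂ)
    (hD : ∀ b : PBond (F.P K) 0, (D b).IsHermitian ∧ Matrix.trace (D b) = 0) {s : ℝ} (hs : ∀ b : PBond (F.P K) 0, ‖D b‖ ≤ s) (hs1 : s ≤ 1)
    {δ Z : ℝ}
    (hdiv : (∑ x : Site (F.P K) 0, ∑ j : Fin 2, ∑ k : Fin 2,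
        ‖(divB (torusT (F.P K) 0) (fun κ z => unitsField (toUField W) ⟨z, κ⟩) (fun κ z => Complex.I • D ⟨z, κ⟩) x) j k‖ ^ 2)
      ≤ δ * (∑ b : PBond (F.P K) 0, ‖D b‖ ^ 2) + Z) :
    (∑ x : Site (F.P K) 0, ∑ j : Fin 2, ∑ k : Fin 2,
        ‖(divB (torusT (F.P K) 0) (fun κ z => unitsField (toUField W) ⟨z, κ⟩) (fun κ z => pertVar W (emb15 W (expHermField D)) ⟨z, κ⟩) x) j k‖ ^ 2)
      ≤ (2 * δ + 48 * s ^ 2) * (∑ b : PBond (F.P K) 0, ‖D b‖ ^ 2) + 2 * Z := by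
  have h1 : ∀ b : PBond (F.P K) 0, ‖D b‖ ≤ 1 := fun b => (hs b).trans hs1
  set Rm : PBond (F.P K) 0 → Matrix (Fin 2) (Fin 2) ℂ := fun b => pertVar W (emb15 W (expHermField D)) b - Complex.I • D b with hRm
  -- additivity: `D^*Y = D^*(iD) + D^*R`
  have hlin : ∀ x : Site (F.P K) 0,
      divB (torusT (F.P K) 0) (fun κ z => unitsField (toUField W) ⟨z, κ⟩) (fun κ z => pertVar W (emb15 W (expHermField D)) ⟨z, κ⟩) x
        = divB (torusT (F.P K) 0) (fun κ z => unitsField (toUField W) ⟨z, κ⟩) (fun κ z => Complex.I • D ⟨z, κ⟩) x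
          + divB (torusT (F.P K) 0) (fun κ z => unitsField (toUField W) ⟨z, κ⟩) (fun κ z => Rm ⟨z, κ⟩) x := by
    intro x
    have e : (fun κ (z : Site (F.P K) 0) => pertVar W (emb15 W (expHermField D)) ⟨z, κ⟩) = (fun κ z => Complex.I • D ⟨z, κ⟩ + Rm ⟨z, κ⟩) := by
      funext κ z; simp only [hRm]; abel
    rw [e]
    exact divB_add_field W (fun κ z => Complex.I • D ⟨z, κ⟩) (fun κ z => Rm ⟨z, κ⟩) x
  -- entrywise `(a+b)² ≤ 2a² + 2b²`
  have hpt : ∀ x : Site (F.P K) 0, ∑ j : Fin 2, ∑ k : Fin 2,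
        ‖(divB (torusT (F.P K) 0) (fun κ z => unitsField (toUField W) ⟨z, κ⟩) (fun κ z => pertVar W (emb15 W (expHermField D)) ⟨z, κ⟩) x) j k‖ ^ 2
      ≤ 2 * ∑ j : Fin 2, ∑ k : Fin 2, ‖(divB (torusT (F.P K) 0) (fun κ z => unitsField (toUField W) ⟨z, κ⟩) (fun κ z => Complex.I • D ⟨z, κ⟩) x) j k‖ ^ 2
        + 2 * ∑ j : Fin 2, ∑ k : Fin 2, ‖(divB (torusT (F.P K) 0) (fun κ z => unitsField (toUField W) ⟨z, κ⟩) (fun κ z => Rm ⟨z, κ⟩) x) j k‖ ^ 2 := by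
    intro x
    rw [hlin x, Finset.mul_sum, Finset.mul_sum, ← Finset.sum_add_distrib]
    refine Finset.sum_le_sum fun j _ => ?_
    rw [Finset.mul_sum, Finset.mul_sum, ← Finset.sum_add_distrib]
    refine Finset.sum_le_sum fun k _ => ?_
    rw [Matrix.add_apply]
    set a := (divB (torusT (F.P K) 0) (fun κ z => unitsField (toUField W) ⟨z, κ⟩) (fun κ z => Complex.I • D ⟨z, κ⟩) x) j k
    set b := (divB (torusT (F.P K) 0) (fun κ z => unitsField (toUField W) ⟨z, κ⟩) (fun κ z => Rm ⟨z, κ⟩) x) j k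
    have hab := norm_add_le a b
    nlinarith [norm_nonneg (a + b), norm_nonneg a, norm_nonneg b, sq_nonneg (‖a‖ - ‖b‖)]
  -- the remainder field is second order
  have hRst := sum_hs_divB_le W Rm
  have hRb : ∑ b : PBond (F.P K) 0, ‖Rm b‖ ^ 2 ≤ s ^ 2 * ∑ b : PBond (F.P K) 0, ‖D b‖ ^ 2 := by
    rw [Finset.mul_sum]
    refine Finset.sum_le_sum fun b _ => ?_
    have hr : ‖Rm b‖ ≤ ‖D b‖ ^ 2 := norm_pertVar_sub_lin_le W D b (hD b) (h1 b)
    have hr' : ‖Rm b‖ ≤ s * ‖D b‖ := hr.trans (by rw [sq]; exact mul_le_mul_of_nonneg_right (hs b) (norm_nonneg _))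
    have := pow_le_pow_left₀ (norm_nonneg _) hr' 2
    nlinarith
  calc _ ≤ ∑ x : Site (F.P K) 0, (2 * ∑ j : Fin 2, ∑ k : Fin 2, ‖(divB (torusT (F.P K) 0) (fun κ z => unitsField (toUField W) ⟨z, κ⟩) (fun κ z => Complex.I • D ⟨z, κ⟩) x) j k‖ ^ 2
        + 2 * ∑ j : Fin 2, ∑ k : Fin 2, ‖(divB (torusT (F.P K) 0) (fun κ z => unitsField (toUField W) ⟨z, κ⟩) (fun κ z => Rm ⟨z, κ⟩) x) j k‖ ^ 2) :=
        Finset.sum_le_sum fun x _ => hpt x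
    _ = 2 * (∑ x : Site (F.P K) 0, ∑ j : Fin 2, ∑ k : Fin 2, ‖(divB (torusT (F.P K) 0) (fun κ z => unitsField (toUField W) ⟨z, κ⟩) (fun κ z => Complex.I • D ⟨z, κ⟩) x) j k‖ ^ 2)
        + 2 * (∑ x : Site (F.P K) 0, ∑ j : Fin 2, ∑ k : Fin 2, ‖(divB (torusT (F.P K) 0) (fun κ z => unitsField (toUField W) ⟨z, κ⟩) (fun κ z => Rm ⟨z, κ⟩) x) j k‖ ^ 2) := by
        rw [Finset.sum_add_distrib, Finset.mul_sum, Finset.mul_sum]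
    _ ≤ 2 * (δ * (∑ b : PBond (F.P K) 0, ‖D b‖ ^ 2) + Z) + 2 * (24 * (s ^ 2 * ∑ b : PBond (F.P K) 0, ‖D b‖ ^ 2)) := by
        have := hRst.trans (mul_le_mul_of_nonneg_left hRb (by norm_num))
        linarith
    _ = (2 * δ + 48 * s ^ 2) * (∑ b : PBond (F.P K) 0, ‖D b‖ ^ 2) + 2 * Z := by ring

end Summit.QuantumFields.YangMills.Theorems.Prop7HessWOfFibreCoreT3Rows

end
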